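import Summits.AtomisticToContinuum.Crystallization.Theorems.FrustratedLawDichotomyStrainedPatchHomLeafTableCheckHcp
import Summits.AtomisticToContinuum.Crystallization.Theorems.FrustratedLawDichotomyStrainedPatchHomLeafTableSums

/-!
# hcp table leaf checker — the FOLD INVARIANT and the ACCUMULATOR FIELDS in `ℤ` (integer layer of the soundness proof)

decomp-a2c hand-2 g24 (crux `AperiodicFrustratedLawGap`, stmt-AtomisticToContinuum-27623; β2-hcp, critic rows 864/865).  hcp twin of hand-1's
`…HomLeafTableFold` + `…HomLeafTableSums` for the fold `foldH` of `…HomLeafTableCheckHcp`: (i) failure is absorbing, so a passing leaf has every label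
either FAR-skipped or TREATED with a table row covering its range; (ii) the accumulator of a passing fold is the fieldwise SUM of the per-label increments
`incrH`; (iii) the centre value `qPosH − qNegH`, the radius `radH` and the increment fields in closed integer form (ten signed classes).  Small proof-side
definitions (`AccH.add`, `stepOKH`, `treatedH`, `incrH`, …); no analysis.  0 sorry; standard axioms.  `--supports stmt-AtomisticToContinuum-27623`.
-/

namespace Summit.AtomisticToContinuum.Crystallization.Theorems.FrustratedLawDichotomyStrainedPatchHomLeafTableCheckHcp

open Summit.AtomisticToContinuum.Crystallization.Theorems.FrustratedLawDichotomyStrainedPatchHomLeafTableCheck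
  (Row QT sgnZ SCN addP addN sx absDiff addP_eq addN_eq addP_sub_addN sgnZ_mul sgnZ_sx natAbs_sgnZ)

/-! ## §1. Proof-side bookkeeping definitions -/

/-- Fieldwise sum of accumulators (`ok` conjoined). -/
def AccH.add (a c : AccH) : AccH :=
  ⟨a.ok && c.ok, a.vP + c.vP, a.vN + c.vN, a.dP + c.dP, a.dN + c.dN, a.sd + c.sd, a.g0P + c.g0P, a.g0N + c.g0N, a.g1P + c.g1P, a.g1N + c.g1N,
   a.g2P + c.g2P, a.g2N + c.g2N, a.g3P + c.g3P, a.g3N + c.g3N, a.g4P + c.g4P, a.g4N + c.g4N, a.g5P + c.g5P, a.g5N + c.g5N,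
   a.g6P + c.g6P, a.g6N + c.g6N, a.g7P + c.g7P, a.g7N + c.g7N, a.g8P + c.g8P, a.g8N + c.g8N, a.g9P + c.g9P, a.g9N + c.g9N, a.cur + c.cur⟩

/-- The label's scaled centre value `q0 = qPosH − qNegH` (meaningful when `qNegH ≤ qPosH`). -/
def q0NH (k : LH) (l : NH) : ℕ := qPosH k l - qNegH k l

/-- The label is FAR for this box: `81·SC ≤ 4·(q0 − r)`. -/
def farBH (k : LH) (l : NH) : Bool := Nat.ble (Nat.mul 81 SCN) (Nat.mul 4 (q0NH k l - radH k l))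

/-- The row found for the label. -/
def rowOfH (tab : QT) (k : LH) (l : NH) : Option Row := QT.findLE (q0NH k l) tab none

/-- The range test of `step3H` for a row. -/
def rangeBH (k : LH) (l : NH) (row : Row) : Bool :=
  Nat.ble row.A (q0NH k l - radH k l) && Nat.ble (q0NH k l + radH k l) row.B && Nat.ble row.t (q0NH k l)

/-- The label passes the step without failure. -/
def stepOKH (tab : QT) (k : LH) (l : NH) : Bool :=
  Nat.ble (qNegH k l + radH k l) (qPosH k l) &&
    (farBH k l || match rowOfH tab k l with | none => false | some row => rangeBH k l row)

/-- The label is TREATED (not far, row found and in range). -/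
def treatedH (tab : QT) (k : LH) (l : NH) : Bool :=
  Nat.ble (qNegH k l + radH k l) (qPosH k l) && !farBH k l &&
    (match rowOfH tab k l with | none => false | some row => rangeBH k l row)

/-- The label's increment: its `step4H` on the empty accumulator (zero if not treated). -/
def incrH (tab : QT) (k : LH) (l : NH) : AccH :=
  match treatedH tab k l, rowOfH tab k l with
  | true, some row => step4H accH0 l (radH k l) row (q0NH k l - row.t)
  | _, _ => accH0

/-! ## §2. Elementary facts about the step -/

/-- `step4H` is additive: it adds the label's increment to the accumulator. [formal bookkeeping] -/
theorem step4H_eq_add (a : AccH) (l : NH) (r : ℕ) (row : Row) (δ : ℕ) : step4H a l r row δ = a.add (step4H accH0 l r row δ) := by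
  cases a
  simp only [step4H, AccH.add, accH0, Bool.and_true]
  congr 1 <;> first | rfl | (rw [addP_eq]) | (rw [addN_eq]) | simp [Nat.add_eq]

/-- Unfolding of the step into the proof-side predicates. [formal bookkeeping] -/
theorem stepH_unfold (tab : QT) (k : LH) (a : AccH) (l : NH) :
    stepH tab k a l =
      (match Nat.ble (qNegH k l + radH k l) (qPosH k l) with
        | true => (match farBH k l with
          | true => a
          | false => (match rowOfH tab k l with
            | none => a.fail
            | some row => (match rangeBH k l row with
              | true => step4H a l (radH k l) row (q0NH k l - row.t)
              | false => a.fail)))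
        | false => a.fail) := by
  rfl

/-- A treated label adds its increment. [formal bookkeeping] -/
theorem stepH_of_treated {tab : QT} {k : LH} {l : NH} (h : treatedH tab k l = true) (a : AccH) : stepH tab k a l = a.add (incrH tab k l) := by
  rw [stepH_unfold]
  unfold incrH
  rw [h]
  unfold treatedH at h
  cases h1 : Nat.ble (qNegH k l + radH k l) (qPosH k l)
  · rw [h1] at h; simp at h
  · rw [h1] at h
    cases h2 : farBH k l
    · rw [h2] at h
      cases h3 : rowOfH tab k l with
      | none => rw [h3] at h; simp at h
      | some row =>
        rw [h3] at h
        simp only [Bool.true_and, Bool.not_false] at h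
        simp only [h]
        exact step4H_eq_add a l (radH k l) row _
    · rw [h2] at h; simp at h

/-- A passing, untreated label is far-skipped: the accumulator is unchanged. [formal bookkeeping] -/
theorem stepH_of_far {tab : QT} {k : LH} {l : NH} (hs : stepOKH tab k l = true) (ht : treatedH tab k l = false) (a : AccH) :
    stepH tab k a l = a := by
  rw [stepH_unfold]
  unfold stepOKH at hs
  unfold treatedH at ht
  cases h1 : Nat.ble (qNegH k l + radH k l) (qPosH k l)
  · rw [h1] at hs; simp at hs
  · rw [h1] at hs ht
    cases h2 : farBH k l
    · rw [h2] at hs ht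
      simp only [Bool.true_and, Bool.false_or, Bool.not_false] at hs ht
      cases h3 : rowOfH tab k l with
      | none => rw [h3] at hs; simp at hs
      | some row => rw [h3] at hs ht; simp only at hs ht; rw [hs] at ht; simp at ht
    · rfl

/-- A failing label sets `ok := false`. [formal bookkeeping] -/
theorem ok_stepH_of_not_stepOK {tab : QT} {k : LH} {l : NH} (hs : stepOKH tab k l = false) (a : AccH) : (stepH tab k a l).ok = false := by
  rw [stepH_unfold]
  unfold stepOKH at hs
  cases h1 : Nat.ble (qNegH k l + radH k l) (qPosH k l)
  · rfl
  · rw [h1] at hs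
    cases h2 : farBH k l
    · rw [h2] at hs
      simp only [Bool.true_and, Bool.false_or] at hs
      cases h3 : rowOfH tab k l with
      | none => rfl
      | some row =>
        rw [h3] at hs; simp only at hs
        simp only [hs]
        rfl
    · rw [h2] at hs; simp at hs

/-- Failure is absorbing for one step. [formal bookkeeping] -/
theorem ok_stepH_of_fail {tab : QT} {k : LH} {a : AccH} {l : NH} (h : a.ok = false) : (stepH tab k a l).ok = false := by
  cases hs : stepOKH tab k l
  · exact ok_stepH_of_not_stepOK hs a
  · cases ht : treatedH tab k l
    · rw [stepH_of_far hs ht]; exact h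
    · rw [stepH_of_treated ht]; simp [AccH.add, h]

/-! ## §3. The fold -/

/-- `foldH` is the left fold of `stepH`. [formal bookkeeping] -/
theorem foldH_eq (tab : QT) (k : LH) : ∀ (ls : List NH) (a : AccH), foldH tab k a ls = ls.foldl (stepH tab k) a
  | [], _ => rfl
  | l :: ls, a => by unfold foldH; rw [List.foldl_cons]; exact foldH_eq tab k ls _

/-- Failure is absorbing for the fold. [formal bookkeeping] -/
theorem ok_foldlH_of_fail (tab : QT) (k : LH) : ∀ (ls : List NH) (a : AccH), a.ok = false → (ls.foldl (stepH tab k) a).ok = false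
  | [], _, h => h
  | _ :: ls, _, h => ok_foldlH_of_fail tab k ls _ (ok_stepH_of_fail h)

/-- ★ **THE FOLD INVARIANT.**  If the fold passes (`ok = true` at the end) then it started with `ok = true`, every label of the list passes its step, and
the final accumulator is the start plus the increments of the treated labels, added in order. [formal bookkeeping] -/
theorem foldl_stepH_eq (tab : QT) (k : LH) : ∀ (ls : List NH) (a : AccH), (ls.foldl (stepH tab k) a).ok = true →
    a.ok = true ∧ (∀ l ∈ ls, stepOKH tab k l = true) ∧
      ls.foldl (stepH tab k) a = (ls.filter (fun l => treatedH tab k l)).foldl (fun acc l => acc.add (incrH tab k l)) a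
  | [], a, h => ⟨h, fun _ hl => (List.not_mem_nil hl).elim, rfl⟩
  | l :: ls, a, h => by
    rw [List.foldl_cons] at h
    cases hs : stepOKH tab k l
    · have := ok_foldlH_of_fail tab k ls _ (ok_stepH_of_not_stepOK hs a)
      rw [h] at this; exact Bool.noConfusion this
    · obtain ⟨hok, hall, heq⟩ := foldl_stepH_eq tab k ls _ h
      refine ⟨?_, ?_, ?_⟩
      · cases ht : treatedH tab k l
        · rwa [stepH_of_far hs ht] at hok
        · rw [stepH_of_treated ht] at hok
          simp only [AccH.add, Bool.and_eq_true] at hok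
          exact hok.1
      · intro l' hl'
        rcases List.mem_cons.1 hl' with rfl | hmem
        · exact hs
        · exact hall l' hmem
      · rw [List.foldl_cons, List.filter_cons]
        cases ht : treatedH tab k l
        · simp only [Bool.false_eq_true, ite_false]
          rw [stepH_of_far hs ht] at heq ⊢; exact heq
        · simp only [ite_true, List.foldl_cons]
          rw [stepH_of_treated ht] at heq ⊢; exact heq

/-- Projections that are additive under `AccH.add` sum along the increment fold. [formal bookkeeping] -/
theorem proj_foldlH_add (π : AccH → ℕ) (hπ : ∀ a c, π (a.add c) = π a + π c) (f : NH → AccH) :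
    ∀ (ls : List NH) (a : AccH), π (ls.foldl (fun acc l => acc.add (f l)) a) = π a + (ls.map (fun l => π (f l))).sum
  | [], a => by simp
  | l :: ls, a => by rw [List.foldl_cons, proj_foldlH_add π hπ f ls, hπ, List.map_cons, List.sum_cons, Nat.add_assoc]

/-- A signed difference of two additive projections sums along the increment fold. [formal bookkeeping] -/
theorem proj_sub_foldlH_add (P N : AccH → ℕ) (hP : ∀ a c, P (a.add c) = P a + P c) (hN : ∀ a c, N (a.add c) = N a + N c)
    (f : NH → AccH) (ls : List NH) (a : AccH) :
    (P (ls.foldl (fun acc l => acc.add (f l)) a) : ℤ) - (N (ls.foldl (fun acc l => acc.add (f l)) a) : ℤ) =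
      (P a : ℤ) - (N a : ℤ) + ((ls.map (fun l => P (f l))).sum : ℤ) - ((ls.map (fun l => N (f l))).sum : ℤ) := by
  rw [proj_foldlH_add P hP f ls a, proj_foldlH_add N hN f ls a]
  push_cast
  ring

/-! ## §4. The centre value and the radius in `ℤ` -/

/-- Unpacking `NH.ok`. [formal bookkeeping] -/
theorem NH.ok_iff (l : NH) : l.ok = true ↔
    (l.m00 : ℤ) = l.b0 * l.b0 ∧ (l.m11 : ℤ) = l.b1 * l.b1 ∧ (l.m22 : ℤ) = l.b2 * l.b2 ∧
    sgnZ l.s01 l.m01 = l.b0 * l.b1 ∧ sgnZ l.s02 l.m02 = l.b0 * l.b2 ∧ sgnZ l.s12 l.m12 = l.b1 * l.b2 ∧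
    sgnZ l.z0 l.a0 = famZ l.fam * (2 * l.b0) ∧ sgnZ l.z1 l.a1 = famZ l.fam * (2 * l.b1) ∧ sgnZ l.z2 l.a2 = famZ l.fam * (2 * l.b2) ∧
    (l.u : ℤ) = famZ l.fam := by
  unfold NH.ok
  simp only [Bool.and_eq_true, decide_eq_true_eq, and_assoc]

/-- ★ The centre value: `qPosH − qNegH = Σⱼ L_vⱼ · (±cⱼ)` in `ℤ`, classes `(b0², b1², b2², b0b1, b0b2, b1b2, 2φb0, 2φb1, 2φb2, φ)` with
`φ = famZ fam`. [formal bookkeeping] -/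
theorem qPosH_sub_qNegH {l : NH} (hl : l.ok = true) (k : LH) :
    ((qPosH k l : ℕ) : ℤ) - ((qNegH k l : ℕ) : ℤ) =
      l.b0 * l.b0 * sgnZ k.s0 k.c0 + l.b1 * l.b1 * sgnZ k.s1 k.c1 + l.b2 * l.b2 * sgnZ k.s2 k.c2 +
      l.b0 * l.b1 * sgnZ k.s3 k.c3 + l.b0 * l.b2 * sgnZ k.s4 k.c4 + l.b1 * l.b2 * sgnZ k.s5 k.c5 +
      famZ l.fam * (2 * l.b0) * sgnZ k.s6 k.c6 + famZ l.fam * (2 * l.b1) * sgnZ k.s7 k.c7 + famZ l.fam * (2 * l.b2) * sgnZ k.s8 k.c8 +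
      famZ l.fam * sgnZ k.s9 k.c9 := by
  obtain ⟨h00, h11, h22, h01, h02, h12, hz0, hz1, hz2, hu⟩ := (NH.ok_iff l).1 hl
  unfold qPosH qNegH
  simp only [Nat.mul_eq]
  rw [addP_eq k.s0, addP_eq k.s1, addP_eq k.s2, addP_eq (sx l.s01 k.s3), addP_eq (sx l.s02 k.s4), addP_eq (sx l.s12 k.s5),
    addP_eq (sx l.z0 k.s6), addP_eq (sx l.z1 k.s7), addP_eq (sx l.z2 k.s8),
    addN_eq k.s0, addN_eq k.s1, addN_eq k.s2, addN_eq (sx l.s01 k.s3), addN_eq (sx l.s02 k.s4), addN_eq (sx l.s12 k.s5),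
    addN_eq (sx l.z0 k.s6), addN_eq (sx l.z1 k.s7), addN_eq (sx l.z2 k.s8)]
  have e0 := addP_sub_addN k.s0 (l.m00 * k.c0)
  have e1 := addP_sub_addN k.s1 (l.m11 * k.c1)
  have e2 := addP_sub_addN k.s2 (l.m22 * k.c2)
  have e3 := addP_sub_addN (sx l.s01 k.s3) (l.m01 * k.c3)
  have e4 := addP_sub_addN (sx l.s02 k.s4) (l.m02 * k.c4)
  have e5 := addP_sub_addN (sx l.s12 k.s5) (l.m12 * k.c5)
  have e6 := addP_sub_addN (sx l.z0 k.s6) (l.a0 * k.c6)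
  have e7 := addP_sub_addN (sx l.z1 k.s7) (l.a1 * k.c7)
  have e8 := addP_sub_addN (sx l.z2 k.s8) (l.a2 * k.c8)
  have e9 := addP_sub_addN k.s9 (l.u * k.c9)
  have f0 : sgnZ k.s0 (l.m00 * k.c0) = (l.m00 : ℤ) * sgnZ k.s0 k.c0 := by cases k.s0 <;> simp [sgnZ]
  have f1 : sgnZ k.s1 (l.m11 * k.c1) = (l.m11 : ℤ) * sgnZ k.s1 k.c1 := by cases k.s1 <;> simp [sgnZ]
  have f2 : sgnZ k.s2 (l.m22 * k.c2) = (l.m22 : ℤ) * sgnZ k.s2 k.c2 := by cases k.s2 <;> simp [sgnZ]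
  have f9 : sgnZ k.s9 (l.u * k.c9) = (l.u : ℤ) * sgnZ k.s9 k.c9 := by cases k.s9 <;> simp [sgnZ]
  rw [f0] at e0; rw [f1] at e1; rw [f2] at e2; rw [f9] at e9
  rw [sgnZ_sx] at e3 e4 e5 e6 e7 e8
  rw [h01] at e3; rw [h02] at e4; rw [h12] at e5; rw [hz0] at e6; rw [hz1] at e7; rw [hz2] at e8
  push_cast at e0 e1 e2 e3 e4 e5 e6 e7 e8 e9 ⊢
  rw [hu] at e9
  rw [← h00, ← h11, ← h22]
  linarith

/-- ★ The radius: `radH = Σⱼ |L_vⱼ| wⱼ` in `ℤ`. [formal bookkeeping] -/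
theorem radH_eq {l : NH} (hl : l.ok = true) (k : LH) :
    ((radH k l : ℕ) : ℤ) = l.b0 * l.b0 * k.w0 + l.b1 * l.b1 * k.w1 + l.b2 * l.b2 * k.w2 +
      |l.b0 * l.b1| * k.w3 + |l.b0 * l.b2| * k.w4 + |l.b1 * l.b2| * k.w5 +
      |famZ l.fam * (2 * l.b0)| * k.w6 + |famZ l.fam * (2 * l.b1)| * k.w7 + |famZ l.fam * (2 * l.b2)| * k.w8 + |famZ l.fam| * k.w9 := by
  obtain ⟨h00, h11, h22, h01, h02, h12, hz0, hz1, hz2, hu⟩ := (NH.ok_iff l).1 hl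
  unfold radH
  simp only [Nat.add_eq, Nat.mul_eq]
  have a01 : ((l.m01 : ℕ) : ℤ) = |l.b0 * l.b1| := by rw [← h01, ← Int.natCast_natAbs, natAbs_sgnZ]
  have a02 : ((l.m02 : ℕ) : ℤ) = |l.b0 * l.b2| := by rw [← h02, ← Int.natCast_natAbs, natAbs_sgnZ]
  have a12 : ((l.m12 : ℕ) : ℤ) = |l.b1 * l.b2| := by rw [← h12, ← Int.natCast_natAbs, natAbs_sgnZ]
  have b0 : ((l.a0 : ℕ) : ℤ) = |famZ l.fam * (2 * l.b0)| := by rw [← hz0, ← Int.natCast_natAbs, natAbs_sgnZ]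
  have b1 : ((l.a1 : ℕ) : ℤ) = |famZ l.fam * (2 * l.b1)| := by rw [← hz1, ← Int.natCast_natAbs, natAbs_sgnZ]
  have b2 : ((l.a2 : ℕ) : ℤ) = |famZ l.fam * (2 * l.b2)| := by rw [← hz2, ← Int.natCast_natAbs, natAbs_sgnZ]
  have bu : ((l.u : ℕ) : ℤ) = |famZ l.fam| := by rw [hu]; cases l.fam <;> simp [famZ]
  push_cast
  rw [h00, h11, h22, a01, a02, a12, b0, b1, b2, bu]
  ring

/-! ## §5. The increment of a treated label -/

/-- The row of a treated label exists and passes the range test. [formal bookkeeping] -/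
theorem rowOfH_of_treated {tab : QT} {k : LH} {l : NH} (h : treatedH tab k l = true) :
    Nat.ble (qNegH k l + radH k l) (qPosH k l) = true ∧ farBH k l = false ∧ ∃ row, rowOfH tab k l = some row ∧ rangeBH k l row = true := by
  unfold treatedH at h
  simp only [Bool.and_eq_true, Bool.not_eq_true'] at h
  obtain ⟨⟨h1, h2⟩, h3⟩ := h
  refine ⟨h1, h2, ?_⟩
  cases hr : rowOfH tab k l with
  | none => rw [hr] at h3; exact Bool.noConfusion h3
  | some row => rw [hr] at h3; exact ⟨row, rfl, h3⟩

/-- The increment of a treated label with row `row`: its signed fields. [formal bookkeeping] -/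
theorem incrH_fields {tab : QT} {k : LH} {l : NH} {row : Row} (h : treatedH tab k l = true) (hr : rowOfH tab k l = some row) :
    (incrH tab k l).ok = true ∧
    (((incrH tab k l).vP : ℕ) : ℤ) - (incrH tab k l).vN = sgnZ row.sV row.aV ∧
    (((incrH tab k l).dP : ℕ) : ℤ) - (incrH tab k l).dN = sgnZ row.sD row.aD * ((q0NH k l - row.t : ℕ) : ℤ) ∧
    (incrH tab k l).sd = q0NH k l - row.t ∧
    (((incrH tab k l).g0P : ℕ) : ℤ) - (incrH tab k l).g0N = sgnZ row.sD row.aD * (l.m00 : ℤ) ∧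
    (((incrH tab k l).g1P : ℕ) : ℤ) - (incrH tab k l).g1N = sgnZ row.sD row.aD * (l.m11 : ℤ) ∧
    (((incrH tab k l).g2P : ℕ) : ℤ) - (incrH tab k l).g2N = sgnZ row.sD row.aD * (l.m22 : ℤ) ∧
    (((incrH tab k l).g3P : ℕ) : ℤ) - (incrH tab k l).g3N = sgnZ row.sD row.aD * sgnZ l.s01 l.m01 ∧
    (((incrH tab k l).g4P : ℕ) : ℤ) - (incrH tab k l).g4N = sgnZ row.sD row.aD * sgnZ l.s02 l.m02 ∧
    (((incrH tab k l).g5P : ℕ) : ℤ) - (incrH tab k l).g5N = sgnZ row.sD row.aD * sgnZ l.s12 l.m12 ∧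
    (((incrH tab k l).g6P : ℕ) : ℤ) - (incrH tab k l).g6N = sgnZ row.sD row.aD * sgnZ l.z0 l.a0 ∧
    (((incrH tab k l).g7P : ℕ) : ℤ) - (incrH tab k l).g7N = sgnZ row.sD row.aD * sgnZ l.z1 l.a1 ∧
    (((incrH tab k l).g8P : ℕ) : ℤ) - (incrH tab k l).g8N = sgnZ row.sD row.aD * sgnZ l.z2 l.a2 ∧
    (((incrH tab k l).g9P : ℕ) : ℤ) - (incrH tab k l).g9N = sgnZ row.sD row.aD * (l.u : ℤ) ∧
    (incrH tab k l).cur = row.M * ((q0NH k l - row.t + radH k l) * (q0NH k l - row.t + radH k l)) := by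
  unfold incrH
  rw [h, hr]
  dsimp only [step4H, accH0]
  refine ⟨rfl, ?_, ?_, ?_, ?_, ?_, ?_, ?_, ?_, ?_, ?_, ?_, ?_, ?_, ?_⟩ <;> (try simp only [Nat.add_eq, Nat.mul_eq, Nat.zero_add])
  · exact addP_sub_addN _ _
  · rw [addP_sub_addN, sgnZ_mul]
  · rw [addP_sub_addN, sgnZ_mul]
  · rw [addP_sub_addN, sgnZ_mul]
  · rw [addP_sub_addN, sgnZ_mul]
  · rw [addP_sub_addN, sgnZ_sx]
  · rw [addP_sub_addN, sgnZ_sx]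
  · rw [addP_sub_addN, sgnZ_sx]
  · rw [addP_sub_addN, sgnZ_sx]
  · rw [addP_sub_addN, sgnZ_sx]
  · rw [addP_sub_addN, sgnZ_sx]
  · rw [addP_sub_addN, sgnZ_mul]

/-- Class magnitudes of an increment are `aD · |L|`. [formal bookkeeping] -/
theorem incrH_gP_add_gN {tab : QT} {k : LH} {l : NH} {row : Row} (h : treatedH tab k l = true) (hr : rowOfH tab k l = some row) :
    (incrH tab k l).g0P + (incrH tab k l).g0N = row.aD * l.m00 ∧ (incrH tab k l).g1P + (incrH tab k l).g1N = row.aD * l.m11 ∧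
    (incrH tab k l).g2P + (incrH tab k l).g2N = row.aD * l.m22 ∧ (incrH tab k l).g3P + (incrH tab k l).g3N = row.aD * l.m01 ∧
    (incrH tab k l).g4P + (incrH tab k l).g4N = row.aD * l.m02 ∧ (incrH tab k l).g5P + (incrH tab k l).g5N = row.aD * l.m12 ∧
    (incrH tab k l).g6P + (incrH tab k l).g6N = row.aD * l.a0 ∧ (incrH tab k l).g7P + (incrH tab k l).g7N = row.aD * l.a1 ∧
    (incrH tab k l).g8P + (incrH tab k l).g8N = row.aD * l.a2 ∧ (incrH tab k l).g9P + (incrH tab k l).g9N = row.aD * l.u := by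
  unfold incrH
  rw [h, hr]
  dsimp only [step4H, accH0]
  simp only [Nat.mul_eq]
  refine ⟨?_, ?_, ?_, ?_, ?_, ?_, ?_, ?_, ?_, ?_⟩
  · cases row.sD <;> simp [addP, addN]
  · cases row.sD <;> simp [addP, addN]
  · cases row.sD <;> simp [addP, addN]
  · cases row.sD <;> cases l.s01 <;> simp [addP, addN, sx]
  · cases row.sD <;> cases l.s02 <;> simp [addP, addN, sx]
  · cases row.sD <;> cases l.s12 <;> simp [addP, addN, sx]
  · cases row.sD <;> cases l.z0 <;> simp [addP, addN, sx]
  · cases row.sD <;> cases l.z1 <;> simp [addP, addN, sx]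
  · cases row.sD <;> cases l.z2 <;> simp [addP, addN, sx]
  · cases row.sD <;> simp [addP, addN]

end Summit.AtomisticToContinuum.Crystallization.Theorems.FrustratedLawDichotomyStrainedPatchHomLeafTableCheckHcp
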